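import Summits.QuantumFields.YangMills.Theorems.BalabanUVNodesN12DirectChartLetterCore
import Literature.MathematicalPhysics.QuantumFieldTheory.Balaban1983to89.Node00.MultiScaleFibreChartB
import Literature.MathematicalPhysics.QuantumFieldTheory.Balaban1983to89.Node00.MultiScaleFibreChartCurvatureUniformB
import HarnessLib

/-!
# DAG node N12 [B15] — THE CHART LETTER, DIRECT ROAD, CORE: the chart-side rows `hΨ₂ ∧ hΨd ∧ hlam ∧ hp ∧ ∀ X, (μ) ∧ (K)` at the curved chart of record WITHOUT the flat — **BOND-DATUM EDITION** (`…N12DirectChartLetterCoreB`, USED DECLARATIONS ONLY)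

The print-datum ([Balaban1984PropagatorsII] (2.3)) (γ) twin of `Summits/…/Theorems/BalabanUVNodesN12DirectChartLetterCore.lean`: the declarations of the parent whose STATEMENT reads the determining datum
(`exists_twistSize_of_nearFlat_feeds`) and which N12's junction of record v14ᴸ uses (dag-n12-c g35 probe-2 census `UsedConstsN12RoadTyped2`, THEOREMS block), re-typed over a
BOND-LEVEL datum `𝔅 : BDetSet` (F0a `B15DeterminingSetsB`) and dag-n12-c's bond-datum chart `Node00.msChartB` (✓p774329; `msChart 𝐁 = msChartB (bondsDet 𝐁)` by `rfl`).  GENERATOR twin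
(this seat's `work/g32/gen_thm.py`, block-extracted from the parent's tree bytes): namespace `…N12DirectChartLetterCoreB`, SAME short names, `DetSet ↦ BDetSet`, `AgreeOn 𝐁 ↦ AgreeOnB 𝔅`,
`IsMinimizer ↦ IsMinimizerB`, `bondsOf (𝐁 j) ↦ 𝔅 j`, `msChart ∕ constrCard ∕ constrEnum ∕ ConstrSet ↦ …B`, NODE 00 chart lemmas `…msChart… ↦ …msChartB…`; proofs VERBATIM; the parent's
datum-free declarations REUSED BY NAME (`open`), never copied (private plumbing excepted, №366 R2).  The parent's (b) statements are the instances `𝔅 := bondsDet 𝐁`.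

Cell `pub-ymgap` (HUMAN RULINGS D-0062 ∕ D-0149), seat `pub-ymgap-dag-n12-d` g32 (R134 N12 [B15] s2; the (ii) Theorems-side re-key of N12's road at print's [II] (2.3) datum — director-ym №338 ∕
№343 (E1)(iii-b), FLAG №16 ∕ ruling (α); dag-n12-c DESIGN memo a793b2ebc0b803bf (ii); `N12-ROAD-TWIN-ORDER-2026-08-30.md`).  Count-neutral helper of K1⁹ `stmt-QuantumFields-27364`,
`--kind proof --supports … --as helper`.  THEOREMS ONLY (0 `def`, 0 `instance`, 0 `sorry`).

HONEST FRAMING (director-ym №338 (5)).  PURELY ADDITIVE: the parent stays landed and true on its own text; nothing in it is edited; no displayed premise of any consumer is deleted or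
weakened; every hypothesis of the parent stays a hypothesis.  Nothing of Bałaban's analysis asserted; N12 NOT discharged; K0⁷ ∕ K1⁹ NOT closed; counts unmoved (typed 28∕28 · discharged
8∕27, A 8∕28; K 1∕4); one finite 𝕋⁴ programme at fixed ε — R4 closes the conditional rung `BalabanLadder.UV` only; NOT the Yang–Mills mass gap (Clay); nothing continuum ∕ ℝ⁴ ∕ OS.

PARENT's DOCSTRING (the mathematics and the citations; read the site-level `𝐁` as the bond datum `𝔅`):
# DAG node N12 [B15] — THE CHART LETTER, DIRECT ROAD, CORE: the chart-side rows `hΨ₂ ∧ hΨd ∧ hlam ∧ hp ∧ ∀ X, (μ) ∧ (K)` at the curved chart of record WITHOUT the flat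
# linearisation (`Lf`, `Rf`, `q`, (δ₂) dropped), from GAUGE-INVARIANT data — the `SmallBelow` guard at `U₀`, PLAQUETTE smallness where the first variation is read — plus TWO displayed
# letters: the curved right inverse `hH` (ONE letter, the (P4) target) and the chart curvature `hM₂`

Cell `pub-ymgap` (HUMAN RULINGS D-0062 ∕ D-0149), width seat `pub-ymgap-dag-n12-w4` g5; plan g87's ruling «(b-direct) GO» (YMPLAN-G87-N12-ROAD) and the lane owner's LAUNCH (dag-n12-c g20,
2026-08-28 ≈17:19Z): «(P1) w4 `Core_direct` = `…N12NearFlatChartLetterNCore` minus the `Lf∕Rf∕q∕(δ₂)` outputs, plus `hmX` — per instance∕`V_k`∕`U₀`∕`X_f`: `∃ Ψ₂ lam p, hΨ₂ ∧ hΨd ∧ hlam ∧ hp ∧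
∀ X, (μ: Cμ·ε-type) ∧ (K: 12𝓐₀∕R·√card) ∧ hmX` under: window tower near-flatness …, PLAQUETTE smallness of `U₀` where the first variation is read (gauge-invariant, for `j`∕`λ`), and — UNTIL (P4)
LANDS — the curved right inverse DISPLAYED as ONE letter `hH : ∃ H real-linear, DΨ_{U₀}(0) ∘ H = id ∧ letter ≤ B`».  Key K1⁹ `stmt-QuantumFields-27364`, `--kind proof --supports … --as helper`;
count-neutral; THEOREMS ONLY.  THIS FILE = the chart rows; `hmX` is the separate theorem `…N12NearFlatFederbushVelocityWindow.exists_hmX_federbush_window_of_isMinimizer_family` (p652991),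
conjoined by the (P2) producer.

THE DISPLAYED LETTERS (exact texts, for (P4) ∕ (X2)(i) to key on; `Ψ := msChart F 2 Kt k (Bj ν.M₁ Z k) (avgFamily (avOfRecord F 2 Kt) (qsstarGIter0 k (ext Vk))) U₀`):
* `hsb : SmallBelow (avOfRecord F 2 Kt) k U₀` — the (0.4) guard down the tower at `U₀` (gauge-invariant; the class of record's plaquette smallness).
* `hP : ∀ p, (a bond of ∂p has its source in Ω₁(Z) = maxDomT ν.M₁ Z 1) → ‖↑(U₀(∂p)) − 1‖ ≤ εP` — PLAQUETTE smallness where the first variation is read (gauge-invariant; [15] (8) ∕ h15T).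
* `hH` = `(H : (Fin (constrCard (Bj ν.M₁ Z k) k) → lieSU (Fin 2)) → PBond (F.P Kt) 0 → lieSU (Fin 2))` with `hHinv : ∀ v, fderiv ℝ Ψ 0 (H v) = v`, `hHB : ∀ v, √(Σ_b ‖H v b‖²) ≤ B·‖v‖`
  (Hilbert–Schmidt norms of `𝔰𝔲(2)`, sup norm of the data `v`), `hHsupp : ∀ v b, b.src ∉ maxDomT ν.M₁ Z 1 → H v b = 0` — A FUNCTION, no linearity needed here.
* `hM₂ : ∀ w, ‖fderiv ℝ (fderiv ℝ Ψ) 0 w w‖ ≤ M₂·‖w‖²` — the chart curvature at `U₀` (today: `Node00.exists_uniform_chartCurvature_sq_bound[_local∕Pos]` at near-flat proxies; gauge-free by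
  compactness over the guard set = the memo's (X2)(i), not typed here).
CONSUMED BY NAME: `Node00.regularity_binders_msChart` (hΨ₂∕hΨd from the guard, p610492), `Node00.exists_lam_msChart_Bj_of_isMinimizer_regMSCoPOfRecord` (hlam from onto-ness + minimality over
the class of record, p610492), dag-n12-w4 g2's plaquette-budget current factor `Node00.abs_deriv_wilsonAction4_expChart_zero_le_local` (p595183) + `Node00.sum_plaq_boundary_eq` (p593907) +
`fderiv_wilsonAction4_expChart_apply_eq_deriv` (p599997), this lineage's `ℓ²(HS)` bookkeeping (`sum_opNorm_sq_le_l2Seminorm_sq`, `sum_opNorm_le_sqrt_card_mul_l2Seminorm`, `l2Seminorm_apply`,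
`l2Seminorm_le_of_bound_of_support`, p629850), `Node00.norm_coe_plaqHol_sub_one_le_two` (p643736).

THE PRINT.  [Balaban1989LargeFieldII] p. 357, (1.12) p. 359 («λ·D²Ψ» — the multiplier term), (1.7) p. 358; [Balaban1985Variational] Sect. C (44)–(48) p. 285, (81)–(83) p. 290;
[Balaban1988Convergent] (2.10)–(2.13) pp. 256–257; [Balaban1989LargeFieldI] (8) p. 279 (the small-plaquette class).

CONTENTS.  §1 `norm_le_l2Seminorm` (sup of the HS norms ≤ the junction seminorm), ★ `abs_fderiv_wilsonAction4_expChart_apply_le_of_plaqSmall_local` (the CURRENT FACTOR from PLAQUETTE smallness: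
`|D(A∘expChart U₀)(0)Y| ≤ 2(d−1)·εP·√#bonds·p(Y)` for `Y` supported in the Ω₁(Z)-sourced bonds — gauge-invariant replacement of `letter_j_wilson_local`).
§3 ★★ `exists_twistSize_of_nearFlat_feeds` (the twist size `‖↑W_k(c) − 1‖ ≤ K_τ·δ` from near-flatness on the tower `feeds k c` ALONE — `hmX`'s `hW′` from
window-tower near-flatness).  §2 ★★★ `chartRows_direct_of_letters` — `∃ Ψ₂ lam p, hΨ₂ ∧ hΨd ∧ hlam ∧ hp ∧ (p(Hv) ≤ B‖v‖) ∧ ∀ X, (μ) λ(Ψ₂(X_f′X,X_f′X)) ≤ (2(d−1)·εP·√#bonds·B·M₂)·p(X_f′X)² ∧ (K) p(X_f′X) ≤ (12𝓐₀∕R·√card)·‖X‖`.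

HONEST FRAMING.  Composition BY NAME over landed kernel theorems; the two displayed letters `hH`, `hM₂` are exactly what (P4) (curved right inverse at plaquette-small backgrounds, n10-w1's
H1-loc + F-multilocal) and (X2)(i) must discharge; per-height∕per-instance constants, NOT print's volume-uniform `O(1)`; nothing of Bałaban's ((1.7), (1.12), Prop. 1) asserted; N12 NOT
discharged; K1⁹ NOT closed; count-neutral (typed 28∕28 · discharged 5∕27 unmoved); one finite 𝕋⁴ programme at fixed ε — R4 closes the conditional rung `BalabanLadder.UV` only; the YM mass
gap (Clay) is NOT proved by any of this.
-/

noncomputable section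

open scoped BigOperators Matrix.Norms.L2Operator Topology
open Filter Finset

namespace Summit.QuantumFields.YangMills.BalabanUVNodes.N12DirectChartLetterCoreB

open Literature.MathematicalPhysics.QuantumFieldTheory.Balaban1983to89.B15DeterminingSetsB

open Literature.MathematicalPhysics.QuantumFieldTheory.Balaban1983to89
open Literature.MathematicalPhysics.QuantumLattice (quatMatrix)
open T4Continuum (T4Family)
open T4HaarSU2ExpChart (imQuat)
open T4AdjointCovarianceUnitary (lieSU)
open T4CubeChartGnomonic (SU2)
open B15DeterminingSets GaugeField
open B14.Eq213DetSet (Bj Bj_of_gt maxDomT)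
open B14.Eq216Concrete (feeds iter_local)
open Summit.QuantumFields.YangMills.BalabanUVNodes.N12GuardedChartDerivIterLin (exists_norm_iterM_sub_one_le)
open B15Prop1SliceCoordinates (GaugeSlice ιA)
open B15Prop1ChartCalculusSU2 (E3)
open B15Prop1ChartSU2 (su2Chart)
open B16Sect1Backgrounds (expMul)
open BlockAveragingEMLLinearised (linAvg)
open Literature.MathematicalPhysics.QuantumFieldTheory.BalabanImbrieJaffe1984to88.BIJ85Eq453GaugeField (qsstarGIter0)
open Node00
open B16Ineq17NearFlatWilsonLetters (fderiv_wilsonAction4_expChart_apply_eq_deriv)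
open Summit.QuantumFields.YangMills.BalabanUVNodes.N12NearFlatChartLetter (sum_opNorm_sq_le_l2Seminorm_sq l2Seminorm_le_sqrt_card_mul_norm
  sum_opNorm_le_sqrt_card_mul_l2Seminorm l2Seminorm_apply l2Seminorm_le_of_bound_of_support)

section
variable {F : T4Family}
variable {Kt : ℕ} {N : ℕ} [NeZero N]

/-- ★★ **THE TWIST SIZE, TOWER-LOCALLY**: one `K_τ ≥ 0`, `ρ_τ > 0` per height `k` such that, for a multi-scale datum `W` and a field `U₀` in its fibre at `𝔅`, at every level-`k` constrained bond
`c`, near-flatness `‖U₀(b) − 1‖ ≤ δ < ρ_τ` on the TOWER `feeds k c` alone gives `‖↑W_k(c) − 1‖ ≤ K_τ·δ` — `W_k(c) = Ū^k(U₀)(c) = Ū^k(U′)(c)` for the proxy `U′ := U₀` on the tower, `1` off it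
([III] (2.11) locality `iter_local`), and `‖Ū^k(U′) − 1‖ ≤ K_τ‖U′ − 1‖` (dag-n12-w4 g3's `exists_norm_iterM_sub_one_le`).  Supplies `hmX`'s twist hypothesis `hW′` from window-tower near-flatness.
[cite: Balaban1988Convergent, (2.11) p.256; Balaban1985Averaging, Thm 1 (27) p.23; Balaban1989LargeFieldII, p.357] -/
theorem exists_twistSize_of_nearFlat_feeds (Kt k : ℕ) :
    ∃ Kτ ρτ : ℝ, 0 ≤ Kτ ∧ 0 < ρτ ∧
      ∀ (𝔅 : BDetSet (F.P Kt)) (W : MSField (F.P Kt) (SU N)) (U₀ : GaugeField (F.P Kt) 0 (SU N)), k ≤ (F.P Kt).m + (F.P Kt).K →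
        AgreeOnB 𝔅 (avgFamily (Node00.avOfRecord F N Kt) U₀) W →
        ∀ c ∈ (𝔅 k), ∀ ⦃δ : ℝ⦄, 0 ≤ δ → δ < ρτ →
        (∀ b ∈ feeds k c, ‖((U₀ b : SU N) : Matrix (Fin N) (Fin N) ℂ) - 1‖ ≤ δ) →
        ‖((W k c : SU N) : Matrix (Fin N) (Fin N) ℂ) - 1‖ ≤ Kτ * δ := by
  obtain ⟨Kτ, ρτ, hKτ, hρτ, hτW⟩ := exists_norm_iterM_sub_one_le (P := F.P Kt) (N := N) k
  obtain ⟨_, ρ'', _, hρ'', hsbU, _⟩ := exists_uniform_chartCurvatureB_sq_bound (F := F) (N := N) (K := Kt) k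
  refine ⟨Kτ, min ρτ ρ'', hKτ, lt_min hρτ hρ'', fun 𝔅 W U₀ hk hU c hc δ hδ0 hδρ hloc => ?_⟩
  -- the proxy: `U₀` on the tower, `1` elsewhere
  obtain ⟨U', hin, hflat⟩ := Node00.exists_nearFlat_eqOn U₀ _ hδ0 hloc
  have hρ1 : ‖coeField U' - 1‖ < ρτ := lt_of_le_of_lt hflat (lt_of_lt_of_le hδρ (min_le_left _ _))
  have hsb' : SmallBelow (Node00.avOfRecord F N Kt) k U' := hsbU U' (hflat.trans ((le_of_lt hδρ).trans (min_le_right _ _)))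
  -- `W_k(c) = Ū^k(U₀)(c) = Ū^k(U′)(c)`
  have hW : W k c = avgFamily (Node00.avOfRecord F N Kt) U' k c := by
    rw [← hU _ _ hc]
    exact iter_local (Node00.avOfRecord F N Kt) _ hk _ _ _ fun b hb => (hin b hb).symm
  have hcoe : coeField (Averaging.iter (Node00.avOfRecord F N Kt) k U') = iterM k (coeField U') := coeField_iter_eq_iterM k hsb'
  have e : ((W k c : SU N) : Matrix (Fin N) (Fin N) ℂ) - 1
      = ((iterM k : (PBond (F.P Kt) 0 → Matrix (Fin N) (Fin N) ℂ) → PBond (F.P Kt) k → Matrix (Fin N) (Fin N) ℂ) (coeField U') - 1) c := by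
    rw [hW, Pi.sub_apply, ← hcoe, coeField_apply, Pi.one_apply]; rfl
  rw [e]
  exact (norm_le_pi_norm _ c).trans ((hτW U' hρ1).trans (mul_le_mul_of_nonneg_left hflat hKτ))

end

end Summit.QuantumFields.YangMills.BalabanUVNodes.N12DirectChartLetterCoreB

end
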